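import Summits.QuantumFields.BalabanUV.T4Continuum.Support.NE7HintOfLocalChart
import Summits.QuantumFields.BalabanUV.T4Continuum.Support.NE7CentralTwist
import Summits.QuantumFields.BalabanUV.T4Continuum.Support.NE7OneStepOfPathOpen
import Summits.QuantumFields.BalabanUV.T4Continuum.Support.AveragingDeficitMultiLevelBridge
import Summits.QuantumFields.BalabanUV.T4Continuum.Support.AveragingDeficitNearIdentity
import Summits.QuantumFields.BalabanUV.T4Continuum.Support.AveragingDeficitPlaqDeriv
import Summits.QuantumFields.BalabanUV.T4Continuum.Support.NE7GradientCurrency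
import Literature.Analysis.Calculus.ExpDifferentialLogQuotient
import HarnessLib

/-!
# NE7LocalChartCoverObstruction — THE CHART HYPOTHESIS OF F282–F286 IS A GLOBAL CHART DEMAND ON SMALL COVERS, AND TORONS REFUTE IT
# (gen 91, CRUX PROVER NE7 #1: a located defect of the `(4ℓ+12)`-fold cover and the quantitative holonomy obstruction; repaired by
# the wide-cover files `NE7HapeOfLocalChartWide` ff.)

Cell `pub-balaban`, rung (B)+1 sub-cell t4, lineage `b2b-balaban-t4-ne7-p1` (CRUX PROVER NE7 #1 = OWNER of row NE7), generation 91; memo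
`t4/b2b-balaban-t4-ne7-p1-g91/COVER-OBSTRUCTION.md`.

THE DEFECT.  F282 `NE7HapeOfLocalChartAllN` … F286 `NE7HintOfLocalChartSU2` ask THE CHART ([B8] Thm 2 at `U₀ = 1`, TYPE) on the
`(4ℓ+12)`-fold cover: agreement `U^{u} = e^{At}` on the torus ball `torusSupNorm (y − z) ≤ (nbRad + 2ℓ + 10)·M` of the cover torus of
period `N(4ℓ+12)·M`, `M = L^{k+1}`.  But `torusSupNorm ≤ N(4ℓ+12)M∕2 = N(2ℓ+6)M` identically, and `nbRad (d+1) L + 2ℓ + 10 ≥ 2ℓ + 10 >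
2ℓ + 6`: for `N(4ℓ+12) ≤ 2(nbRad + 2ℓ + 10)` (every `ℓ` at `N = 1`; `N ≤ 4` at `d + 1 = 4`, `L = 2`, where `nbRad = 20`) the ball is
the WHOLE cover torus and the chart is a GLOBAL one: `U^{u} = e^{At}` EVERYWHERE with `u` periodic and `M·‖At‖ ≤ C₀·(r + 4(e^β − 1) + ε)`.
THE OBSTRUCTION (§2).  A periodic `u` cannot straighten a toron: for the constant scalar configuration `U ≡ e^{iπ∕P}·1` (`P` the period; flat,
unitary, in every small-field class, tangent-critical, admissible over its own constant average) the straight holonomy around the torus is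
`u(0)·(−1)·u(0)⁻¹ = −1`, while `e^{At}` with `‖At‖ ≤ a₀` has straight holonomy within `P(e^{a₀} − 1)` of `1`; so `2 ≤ P(e^{a₀} − 1)`
(`two_le_of_global_chart`).  With the chart's `a₀ ≤ C₀t∕M`, `t = 4(e^β − 1) + ε` (`r = 0`), `P = N(4ℓ+12)M`: `P·a₀ ≤ N(4ℓ+12)·C₀·t`, which
the regime of F284b∕F285 (`ℓ` first, then `ε → 0`, `β → 0`, `C₀ ≤ A(ℓ+1)^p`) makes `< 1` — contradiction (§3 **`not_chart_cover12`**: the chart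
binder of F285 `hint_of_localChart`, VERBATIM, is FALSE whenever `N(4ℓ+12) ≤ 2(nbRad (d+1) L + 2ℓ + 10)` and `N(4ℓ+12)·C₀·(4(e^β−1)+ε) < 1`).
CONSEQUENCE.  At `N = 1` (the unit torus) the bills of F282–F286 are unpayable as typed; the road itself is sound — the repair is a WIDER cover
(factor `Kc ≥ 2·nbRad + 4ℓ + 24`, so that the chart ball is a proper sub-box and torons are locally pure gauges): files `NE7HapeOfLocalChartWide`,
`NE7OneStepOfLocalChartWide`, … (this generation), whose chart hypothesis carries a free cover factor `Kc ≥ 4ℓ + 12`.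

WHAT ([folklore]; 0 def, 0 sorry; every dimension `d + 1`, every `L ≥ 1`, `U(n)` with `n` non-empty).
§1 the toron `scalarCfg (fun _ _ ↦ iθ)`: unitary, periodic, flat, small-field of every radius, tangent-critical, its `j`-fold average is the
   toron `e^{iL^jθ}` (`avgIter_toron`), its straight holonomy (`val_hol_toron_seg`, central: `hol_toron_seg_central`).
§2 **`two_le_of_global_chart`** — the holonomy obstruction `2 ≤ P·(e^{a₀} − 1)`.
§3 **`not_chart_cover12`** — the negation of F285's chart binder under the two displayed smallness conditions; **`not_chart_cover12_one`** — `N = 1`.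

HONEST FRAMING (page 1): a NEGATIVE bookkeeping result about OUR OWN hypothesis (F282–F286's chart binder), not about Bałaban's theorem ([B8] Thm 2
is local and is not touched); nothing of Bałaban's asserted; NE7 NOT PRINTED ∕ NOT PROVED; spine 0∕9; finite T⁴ rung (B)+1 — NOT infinite volume, NOT
mass gap, NOT `BetaPertH`, NOT Clay.  Continuum YM on T⁴ ⇐ BetaPertH ∧ nine spine estimates (0/9 proved); BetaPertH ⇐ (D1) ∧ (D4) ∧ CAP+tail;
G-an2-4 gates asym, D1 and NE2/3/4.  No `sorry`; axioms ⊆ {propext, Classical.choice, Quot.sound}.  PLACEMENT: our lemma, under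
`Summits/QuantumFields/BalabanUV/`.
-/

open scoped BigOperators Matrix Matrix.Norms.L2Operator Topology
open NormedSpace Finset Set Filter

namespace Summit.QuantumFields.BalabanUV.T4Continuum.NE7LocalChartCoverObstruction

open Literature.MathematicalPhysics.QuantumFieldTheory.Balaban1983to89
open B7Prop1Explicit B7Prop2Explicit MatrixLog UnitaryModel
open B4TorusKernel.MultiPeriod (torusSupNorm circAbs two_mul_circAbs_le circAbs_nonneg)
open T4AveragingDeficitWall (IsUnitaryCfg IsSkewDir SmallField vary curl curlSq dirSq dirL1)
open T4AveragingDeficitWallBoundary (IsPeriodicCfg periodBox scalarCfg)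
open AveragingDeficitPeriodicCounting (IsPeriodicDir)
open AveragingDeficitMultiLevelPrep (LevelSmall tower TangentIter cavgIter)
open AveragingDeficitMultiLevelBridge (cavgIter_eq_avgIter)
open AveragingDeficitNearIdentity (norm_hol_sub_one_le_of_bonds)
open AveragingDeficitPlaqDeriv (vary_isUnitaryCfg)
open BlockAverageVaryHolo (nbRad)
open MinimalActionLevels (perWin)
open MinimalActionSandwich (IsMinimiser admissible)
open MinimalActionRate (sfClass)
open MinimalActionWitness (flatCfg avgIter_flatCfg)
open MinimalActionClassSixNeg (isUnitaryCfg_scalarCfg_imag)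
open NE3HessForm (dAction)
open NE3EnergyShapes (IsUnitarySite)
open NE3FramePotBound (isUnitaryCfg_flat)
open BlockAveragePushDirSplit (flat)
open NE7CentralTwist (central_scalarCfg hol_scalarConst_plaqWord hol_scalarConst_seg cavgIter_mul_scalarConst units_comm_of_central)
open NE7OneStepOfPathOpen (dAction_eq_zero_of_flat)
open NE7GradientCurrency (vary_flat_one_apply)
open FederbushMean (cexp_smul_one)
open Literature.Analysis.Calculus.ExpDifferential (norm_exp_sub_one_le_exp_norm_sub_one)

noncomputable section

variable {d : ℕ} {n : Type*} [Fintype n] [DecidableEq n]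

/-! ## §1 The toron `e^{iθ}·1` (one and the same scalar on every link) -/

section Toron

variable (θ : ℝ)

/-- The toron is `U(n)`-valued. [folklore] -/
theorem isUnitaryCfg_toron : IsUnitaryCfg (scalarCfg (n := n) (fun (_ : Site d) (_ : Fin d) => ((θ : ℝ) : ℂ) * Complex.I)) :=
  isUnitaryCfg_scalarCfg_imag (n := n) (fun _ _ => θ)

/-- The toron is periodic with every period. [folklore] -/
theorem isPeriodicCfg_toron (P : ℤ) : IsPeriodicCfg (scalarCfg (n := n) (fun (_ : Site d) (_ : Fin d) => ((θ : ℝ) : ℂ) * Complex.I)) P :=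
  fun _ _ _ => rfl

/-- The toron is flat: every plaquette variable is `1`. [folklore] -/
theorem hol_toron_plaqWord (x : Site d) (κ κ' : Fin d) :
    hol (scalarCfg (n := n) (fun (_ : Site d) (_ : Fin d) => ((θ : ℝ) : ℂ) * Complex.I)) x (plaqWord κ κ') = 1 :=
  hol_scalarConst_plaqWord (n := n) (fun _ => ((θ : ℝ) : ℂ) * Complex.I) x κ κ'

/-- The toron lies in the small-field class of every radius `a ≥ 0`. [folklore] -/
theorem smallField_toron {a : ℝ} (ha : 0 ≤ a) : SmallField (scalarCfg (n := n) (fun (_ : Site d) (_ : Fin d) => ((θ : ℝ) : ℂ) * Complex.I)) a := by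
  intro x κ κ' _
  rw [hol_toron_plaqWord, Units.val_one, sub_self, norm_zero]
  exact ha

/-- The toron is tangent-critical (indeed critical in every skew direction, being flat). [folklore] -/
theorem dAction_toron [Nonempty n] {φ : Site d → Fin d → (Matrix n n ℂ)} (hφ : IsSkewDir φ) (W : Finset (T4AveragingDeficitWall.Plaq d)) :
    dAction (scalarCfg (n := n) (fun (_ : Site d) (_ : Fin d) => ((θ : ℝ) : ℂ) * Complex.I)) φ W = 0 :=
  dAction_eq_zero_of_flat (isUnitaryCfg_toron θ) (smallField_toron θ le_rfl) hφ W

/-- The toron as the flat configuration times constant scalars (the shape of `NE7CentralTwist`). [folklore] -/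
theorem toron_eq_flatCfg_mul :
    scalarCfg (n := n) (fun (_ : Site d) (_ : Fin d) => ((θ : ℝ) : ℂ) * Complex.I)
      = fun y μ => (flatCfg : Site d → Fin d → (Matrix n n ℂ)ˣ) y μ * scalarCfg (n := n) (fun (_ : Site d) (ν : Fin d) => (fun _ : Fin d => ((θ : ℝ) : ℂ) * Complex.I) ν) y μ := by
  funext y μ
  rw [show (flatCfg : Site d → Fin d → (Matrix n n ℂ)ˣ) y μ = 1 from rfl, one_mul]

/-- **THE `j`-FOLD AVERAGE OF THE TORON `e^{iθ}` IS THE TORON `e^{iL^jθ}`.** [folklore] -/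
theorem avgIter_toron (L j : ℕ) :
    avgIter L (scalarCfg (n := n) (fun (_ : Site d) (_ : Fin d) => ((θ : ℝ) : ℂ) * Complex.I)) j
      = scalarCfg (n := n) (fun (_ : Site d) (_ : Fin d) => (((L : ℝ) ^ j * θ : ℝ) : ℂ) * Complex.I) := by
  rw [← cavgIter_eq_avgIter, toron_eq_flatCfg_mul, cavgIter_mul_scalarConst, cavgIter_eq_avgIter, avgIter_flatCfg]
  funext y μ
  rw [show (flatCfg : Site d → Fin d → (Matrix n n ℂ)ˣ) y μ = 1 from rfl, one_mul]
  simp only [scalarCfg]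
  congr 2
  push_cast
  ring

/-- **THE STRAIGHT HOLONOMY OF THE TORON**: `U([x, x + Pe_κ]) = e^{iPθ}·1`. [folklore] -/
theorem val_hol_toron_seg (x : Site d) (κ : Fin d) (P : ℕ) :
    ((hol (scalarCfg (n := n) (fun (_ : Site d) (_ : Fin d) => ((θ : ℝ) : ℂ) * Complex.I)) x (seg κ (P : ℤ)) : (Matrix n n ℂ)ˣ) : (Matrix n n ℂ))
      = Complex.exp ((P : ℂ) * (((θ : ℝ) : ℂ) * Complex.I)) • (1 : (Matrix n n ℂ)) := by
  rw [hol_scalarConst_seg (n := n) (fun _ => ((θ : ℝ) : ℂ) * Complex.I) x κ P, val_expUnit, cexp_smul_one]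

/-- The straight holonomy of the toron is central. [folklore] -/
theorem hol_toron_seg_central (x : Site d) (κ : Fin d) (P : ℕ) (X : (Matrix n n ℂ)) :
    ((hol (scalarCfg (n := n) (fun (_ : Site d) (_ : Fin d) => ((θ : ℝ) : ℂ) * Complex.I)) x (seg κ (P : ℤ)) : (Matrix n n ℂ)ˣ) : (Matrix n n ℂ)) * X
      = X * ((hol (scalarCfg (n := n) (fun (_ : Site d) (_ : Fin d) => ((θ : ℝ) : ℂ) * Complex.I)) x (seg κ (P : ℤ)) : (Matrix n n ℂ)ˣ) : (Matrix n n ℂ)) := by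
  rw [val_hol_toron_seg, smul_mul_assoc, one_mul, mul_smul_comm, mul_one]

end Toron

/-! ## §2 The holonomy obstruction: a periodic gauge cannot chart the toron `e^{iπ∕P}` by a small potential -/

/-- `‖(−1) − 1‖ = 2` in `M_n(ℂ)` (`n` non-empty). [folklore] -/
theorem norm_neg_one_sub_one [Nonempty n] : ‖(-1 : (Matrix n n ℂ)) - 1‖ = 2 := by
  rw [show (-1 : (Matrix n n ℂ)) - 1 = -((2 : ℝ) • (1 : (Matrix n n ℂ))) by rw [two_smul]; abel, norm_neg, norm_smul, norm_one, mul_one,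
    Real.norm_eq_abs, abs_of_pos two_pos]

/-- **THE HOLONOMY OBSTRUCTION.**  If a `P`-periodic gauge `u` (in the `0`-th direction at the origin suffices) charts the toron
`U ≡ e^{iπ∕P}·1` GLOBALLY by a potential, `U^{u} = e^{At}` with `‖At‖ ≤ a₀` and `At` skew, then `2 ≤ P·(e^{a₀} − 1)`: the straight
holonomy of `U^{u}` around the torus is `u(0)·e^{iπ}·u(0)⁻¹ = −1`, that of `e^{At}` is within `P(e^{a₀} − 1)` of `1`. [folklore] -/
theorem two_le_of_global_chart [Nonempty n] {P : ℕ} (hP : 1 ≤ P) {u : Site (d + 1) → (Matrix n n ℂ)ˣ}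
    (huP : u (0 + (P : ℤ) • e (0 : Fin (d + 1))) = u 0)
    {At : Site (d + 1) → Fin (d + 1) → (Matrix n n ℂ)} (hAs : IsSkewDir At) {a₀ : ℝ} (hAt : ∀ (y : Site (d + 1)) (κ : Fin (d + 1)), ‖At y κ‖ ≤ a₀)
    (hagree : gaugeAct u (scalarCfg (n := n) (fun (_ : Site (d + 1)) (_ : Fin (d + 1)) => ((Real.pi / P : ℝ) : ℂ) * Complex.I))
      = vary (flat (d := d + 1) (n := n)) At 1) :
    2 ≤ (P : ℝ) * (Real.exp a₀ - 1) := by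
  set U : Site (d + 1) → Fin (d + 1) → (Matrix n n ℂ)ˣ :=
    scalarCfg (n := n) (fun (_ : Site (d + 1)) (_ : Fin (d + 1)) => ((Real.pi / P : ℝ) : ℂ) * Complex.I) with hUdef
  have hP0 : (P : ℝ) ≠ 0 := by exact_mod_cast (by omega : P ≠ 0)
  -- the straight holonomy of `U^{u}` around the torus is `−1`
  have hhol : ((hol (vary (flat (d := d + 1) (n := n)) At 1) 0 (seg (0 : Fin (d + 1)) (P : ℤ)) : (Matrix n n ℂ)ˣ) : (Matrix n n ℂ)) = -1 := by
    rw [← hagree, hol_gaugeAct, disp_seg, huP, Units.val_mul, Units.val_mul,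
      ← hol_toron_seg_central (n := n) (Real.pi / P) 0 0 P, mul_assoc, Units.mul_inv, mul_one, val_hol_toron_seg]
    have h1 : (P : ℂ) * ((((Real.pi / P : ℝ)) : ℂ) * Complex.I) = (Real.pi : ℂ) * Complex.I := by
      have hP0' : (P : ℂ) ≠ 0 := by exact_mod_cast (by omega : P ≠ 0)
      push_cast
      field_simp
    rw [h1, Complex.exp_pi_mul_I, neg_smul, one_smul]
  -- the straight holonomy of `e^{At}` is within `P(e^{a₀} − 1)` of `1`
  have hWu : IsUnitaryCfg (vary (flat (d := d + 1) (n := n)) At 1) := vary_isUnitaryCfg isUnitaryCfg_flat hAs 1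
  have hbond : ∀ b ∈ AveragingDeficitLocality.bondsOf (0 : Site (d + 1)) (seg (0 : Fin (d + 1)) (P : ℤ)),
      ‖((vary (flat (d := d + 1) (n := n)) At 1 b.1 b.2 : (Matrix n n ℂ)ˣ) : (Matrix n n ℂ)) - 1‖ ≤ Real.exp a₀ - 1 := by
    intro b _
    rw [vary_flat_one_apply, val_expUnit]
    exact (norm_exp_sub_one_le_exp_norm_sub_one _).trans (by gcongr; exact hAt b.1 b.2)
  have hnear := norm_hol_sub_one_le_of_bonds hWu 0 (seg (0 : Fin (d + 1)) (P : ℤ)) hbond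
  rw [hhol, norm_neg_one_sub_one, length_seg, Int.natAbs_natCast] at hnear
  exact hnear

/-! ## §3 The chart binder of F285 (`NE7HintOfLocalChart.hint_of_localChart`), verbatim, is FALSE on small covers -/

/-- The torus sup-distance never exceeds half the period: `torusSupNorm (fun _ ↦ Q) x ≤ Q∕2`. [folklore] -/
theorem torusSupNorm_le_half (Q : ℕ) (x : Site (d + 1)) : torusSupNorm (fun _ : Fin (d + 1) => Q) x ≤ (Q : ℝ) / 2 := by
  unfold torusSupNorm
  refine Finset.sup'_le _ _ fun i _ => ?_
  have h := two_mul_circAbs_le Q (x i)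
  have h' : (2 : ℝ) * (circAbs Q (x i) : ℝ) ≤ (Q : ℝ) := by exact_mod_cast h
  linarith

/-- **THE CHART BINDER OF F282–F286 IS FALSE ON SMALL COVERS.**  For every `L ≥ 1`, `ℓ`, `N ≥ 1`, `ε ≥ 0`, `β ≥ 0`, `C₀`, `C₁` with
(i) `N(4ℓ+12) ≤ 2(nbRad (d+1) L + 2ℓ + 10)` (the chart ball is the whole cover torus — e.g. `N = 1`, every `ℓ`) and
(ii) `N(4ℓ+12)·C₀·(4(e^β − 1) + ε) < 1` (the regime of F284b∕F285: `ℓ` first, then `ε, β → 0`, `C₀ ≤ A(ℓ+1)^p`),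
the chart hypothesis of `NE7HintOfLocalChart.hint_of_localChart` (there with `r ≤ ε∕L²`; VERBATIM) FAILS: the toron `e^{iπ∕(N(4ℓ+12)L)}·1`
at level `k + 1 = 1` is an admissible tangent-critical small-field configuration over its own (constant, flat) average, and
`two_le_of_global_chart` contradicts (ii). [folklore] -/
theorem not_chart_cover12 [Nonempty n] {L : ℕ} [NeZero L] (hL : 1 ≤ L) (ℓ : ℕ) {N : ℕ} [NeZero N] (hN : 1 ≤ N) {ε β C₀ C₁ : ℝ}
    (hε : 0 ≤ ε) (hβ : 0 ≤ β)
    (hcov : N * (4 * ℓ + 12) ≤ 2 * (nbRad (d + 1) L + 2 * ℓ + 10))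
    (hsmall : ((N * (4 * ℓ + 12) : ℕ) : ℝ) * C₀ * (4 * (Real.exp β - 1) + ε) < 1) :
    ¬ (∀ D : Site (d + 1) → Fin (d + 1) → (Matrix n n ℂ)ˣ, IsUnitaryCfg D → IsPeriodicCfg D ((N * (4 * ℓ + 12)) : ℤ) → SmallField D (4 * (Real.exp β - 1)) →
      ∀ (k : ℕ), ∀ U ∈ admissible (sfClass (d + 1) L (N * (4 * ℓ + 12)) ε) L (k + 1) D,
      (∀ φ : Site (d + 1) → Fin (d + 1) → Matrix n n ℂ, IsSkewDir φ → IsPeriodicDir φ (((N * (4 * ℓ + 12)) * L ^ (k + 1) : ℕ) : ℤ) → TangentIter L k U φ →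
        dAction U φ (perWin (d + 1) ((N * (4 * ℓ + 12)) * L ^ (k + 1))) = 0) →
      ∀ r : ℝ, 0 ≤ r → r ≤ (1 / (L : ℝ) ^ 2 * ε) → SmallField U (r / ((L : ℝ) ^ (k + 1)) ^ 2) →
      ∀ z : Site (d + 1), ∃ (u : Site (d + 1) → (Matrix n n ℂ)ˣ) (At : Site (d + 1) → Fin (d + 1) → Matrix n n ℂ) (a₀ a₁ : ℝ),
        IsUnitarySite u ∧ (∀ (y : Site (d + 1)) (i : Fin (d + 1)), u (y + (((N * (4 * ℓ + 12)) * L ^ (k + 1) : ℕ) : ℤ) • e i) = u y) ∧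
        IsSkewDir At ∧ IsPeriodicDir At (((N * (4 * ℓ + 12)) * L ^ (k + 1) : ℕ) : ℤ) ∧ 0 ≤ a₀ ∧ 0 ≤ a₁ ∧
        (∀ (y : Site (d + 1)) (κ : Fin (d + 1)), ‖At y κ‖ ≤ a₀) ∧ (∀ (y : Site (d + 1)) (κ τ : Fin (d + 1)), ‖At (y + e τ) κ - At y κ‖ ≤ a₁) ∧
        (L : ℝ) ^ (k + 1) * a₀ ≤ C₀ * (r + 4 * (Real.exp β - 1) + ε) ∧ ((L : ℝ) ^ (k + 1)) ^ 2 * a₁ ≤ C₁ * (r + 4 * (Real.exp β - 1) + ε) ∧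
        (∀ (y : Site (d + 1)) (κ : Fin (d + 1)),
          torusSupNorm (fun _ : Fin (d + 1) => L ^ (k + 1) * (N * (4 * ℓ + 12))) (y - z) ≤ (((nbRad (d + 1) L + 2 * ℓ + 10) * L ^ (k + 1) : ℕ) : ℝ) →
            gaugeAct u U y κ = vary (flat (d := d + 1) (n := n)) At 1 y κ)) := by
  intro hchart
  -- the period of the cover at level `k + 1 = 1` and the toron angle
  set P : ℕ := N * (4 * ℓ + 12) * L ^ (0 + 1) with hPdef
  have hm : 1 ≤ 4 * ℓ + 12 := by omega
  have hP1 : 1 ≤ P := by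
    rw [hPdef, zero_add, pow_one]
    exact Nat.one_le_iff_ne_zero.mpr (Nat.mul_ne_zero (Nat.mul_ne_zero (NeZero.ne N) (by omega)) (NeZero.ne L))
  set θ : ℝ := Real.pi / P with hθdef
  set U : Site (d + 1) → Fin (d + 1) → (Matrix n n ℂ)ˣ := scalarCfg (n := n) (fun (_ : Site (d + 1)) (_ : Fin (d + 1)) => ((θ : ℝ) : ℂ) * Complex.I) with hUdef
  set D : Site (d + 1) → Fin (d + 1) → (Matrix n n ℂ)ˣ :=
    scalarCfg (n := n) (fun (_ : Site (d + 1)) (_ : Fin (d + 1)) => (((L : ℝ) ^ (0 + 1) * θ : ℝ) : ℂ) * Complex.I) with hDdef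
  -- the datum: unitary, periodic, flat
  have hDu : IsUnitaryCfg D := isUnitaryCfg_toron _
  have hDP : IsPeriodicCfg D ((N * (4 * ℓ + 12)) : ℤ) := isPeriodicCfg_toron _ _
  have hβ' : 0 ≤ 4 * (Real.exp β - 1) := by nlinarith [Real.add_one_le_exp β]
  have hDs : SmallField D (4 * (Real.exp β - 1)) := smallField_toron _ hβ'
  -- the configuration: admissible over `D` at level `1`, tangent-critical, small field of radius `0`
  have hUu : IsUnitaryCfg U := isUnitaryCfg_toron _
  have hUadm : U ∈ admissible (sfClass (d + 1) L (N * (4 * ℓ + 12)) ε) L (0 + 1) D := by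
    refine ⟨⟨hUu, isPeriodicCfg_toron _ _, smallField_toron _ (by positivity)⟩, ?_⟩
    rw [hUdef, avgIter_toron]
  have hcrit : ∀ φ : Site (d + 1) → Fin (d + 1) → Matrix n n ℂ, IsSkewDir φ →
      IsPeriodicDir φ (((N * (4 * ℓ + 12)) * L ^ (0 + 1) : ℕ) : ℤ) → TangentIter L 0 U φ →
      dAction U φ (perWin (d + 1) ((N * (4 * ℓ + 12)) * L ^ (0 + 1))) = 0 :=
    fun φ hφ _ _ => dAction_toron _ hφ _
  have hr : (0 : ℝ) ≤ 1 / (L : ℝ) ^ 2 * ε := by positivity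
  have hU0 : SmallField U (0 / ((L : ℝ) ^ (0 + 1)) ^ 2) := by rw [zero_div]; exact smallField_toron _ le_rfl
  obtain ⟨u, At, a₀, a₁, _, huP, hAs, _, ha₀, _, hAt, _, hb₀, _, hagree⟩ :=
    hchart D hDu hDP hDs 0 U hUadm hcrit 0 le_rfl hr hU0 0
  -- the chart ball is the whole torus: agreement everywhere
  have hball : ∀ y : Site (d + 1),
      torusSupNorm (fun _ : Fin (d + 1) => L ^ (0 + 1) * (N * (4 * ℓ + 12))) (y - 0) ≤ (((nbRad (d + 1) L + 2 * ℓ + 10) * L ^ (0 + 1) : ℕ) : ℝ) := by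
    intro y
    refine (torusSupNorm_le_half _ _).trans ?_
    have h2 : L ^ (0 + 1) * (N * (4 * ℓ + 12)) ≤ (nbRad (d + 1) L + 2 * ℓ + 10) * L ^ (0 + 1) * 2 :=
      calc L ^ (0 + 1) * (N * (4 * ℓ + 12)) ≤ L ^ (0 + 1) * (2 * (nbRad (d + 1) L + 2 * ℓ + 10)) := Nat.mul_le_mul_left _ hcov
        _ = (nbRad (d + 1) L + 2 * ℓ + 10) * L ^ (0 + 1) * 2 := by ring
    rw [div_le_iff₀ (two_pos : (0 : ℝ) < 2)]
    exact_mod_cast h2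
  have hglob : gaugeAct u U = vary (flat (d := d + 1) (n := n)) At 1 := funext fun y => funext fun κ => hagree y κ (hball y)
  -- the holonomy obstruction
  have huP0 : u (0 + (P : ℤ) • e (0 : Fin (d + 1))) = u 0 := huP 0 0
  have hobs : 2 ≤ (P : ℝ) * (Real.exp a₀ - 1) := two_le_of_global_chart (n := n) hP1 huP0 hAs hAt (by rw [hUdef] at hglob; exact hglob)
  -- versus the chart's smallness: `P·a₀ ≤ N(4ℓ+12)·C₀·t < 1`
  have hPa : (P : ℝ) * a₀ ≤ ((N * (4 * ℓ + 12) : ℕ) : ℝ) * C₀ * (4 * (Real.exp β - 1) + ε) := by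
    have h1 : (P : ℝ) = ((N * (4 * ℓ + 12) : ℕ) : ℝ) * (L : ℝ) ^ (0 + 1) := by rw [hPdef]; push_cast; ring
    rw [h1, mul_assoc, mul_assoc]
    refine mul_le_mul_of_nonneg_left ?_ (by positivity)
    simpa using hb₀
  have hPa1 : (P : ℝ) * a₀ < 1 := hPa.trans_lt hsmall
  have hP1r : (1 : ℝ) ≤ (P : ℝ) := by exact_mod_cast hP1
  have ha₀1 : a₀ ≤ 1 := by nlinarith
  have hexp : Real.exp a₀ - 1 ≤ 2 * a₀ := by
    have h := Real.abs_exp_sub_one_sub_id_le (by rw [abs_of_nonneg ha₀]; exact ha₀1)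
    have h' := (abs_le.mp h).2
    nlinarith
  have : (P : ℝ) * (Real.exp a₀ - 1) < 2 := by nlinarith
  linarith

/-- **AT `N = 1` (the unit torus) THE CHART BINDER OF F282–F286 IS FALSE FOR EVERY `ℓ`** as soon as `(4ℓ+12)·C₀·(4(e^β−1)+ε) < 1`
(`nbRad (d+1) L ≥ 0` makes the cover condition automatic). [folklore] -/
theorem not_chart_cover12_one [Nonempty n] {L : ℕ} [NeZero L] (hL : 1 ≤ L) (ℓ : ℕ) {ε β C₀ C₁ : ℝ} (hε : 0 ≤ ε) (hβ : 0 ≤ β)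
    (hsmall : ((4 * ℓ + 12 : ℕ) : ℝ) * C₀ * (4 * (Real.exp β - 1) + ε) < 1) :
    ¬ (∀ D : Site (d + 1) → Fin (d + 1) → (Matrix n n ℂ)ˣ, IsUnitaryCfg D → IsPeriodicCfg D ((1 * (4 * ℓ + 12)) : ℤ) → SmallField D (4 * (Real.exp β - 1)) →
      ∀ (k : ℕ), ∀ U ∈ admissible (sfClass (d + 1) L (1 * (4 * ℓ + 12)) ε) L (k + 1) D,
      (∀ φ : Site (d + 1) → Fin (d + 1) → Matrix n n ℂ, IsSkewDir φ → IsPeriodicDir φ (((1 * (4 * ℓ + 12)) * L ^ (k + 1) : ℕ) : ℤ) → TangentIter L k U φ →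
        dAction U φ (perWin (d + 1) ((1 * (4 * ℓ + 12)) * L ^ (k + 1))) = 0) →
      ∀ r : ℝ, 0 ≤ r → r ≤ (1 / (L : ℝ) ^ 2 * ε) → SmallField U (r / ((L : ℝ) ^ (k + 1)) ^ 2) →
      ∀ z : Site (d + 1), ∃ (u : Site (d + 1) → (Matrix n n ℂ)ˣ) (At : Site (d + 1) → Fin (d + 1) → Matrix n n ℂ) (a₀ a₁ : ℝ),
        IsUnitarySite u ∧ (∀ (y : Site (d + 1)) (i : Fin (d + 1)), u (y + (((1 * (4 * ℓ + 12)) * L ^ (k + 1) : ℕ) : ℤ) • e i) = u y) ∧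
        IsSkewDir At ∧ IsPeriodicDir At (((1 * (4 * ℓ + 12)) * L ^ (k + 1) : ℕ) : ℤ) ∧ 0 ≤ a₀ ∧ 0 ≤ a₁ ∧
        (∀ (y : Site (d + 1)) (κ : Fin (d + 1)), ‖At y κ‖ ≤ a₀) ∧ (∀ (y : Site (d + 1)) (κ τ : Fin (d + 1)), ‖At (y + e τ) κ - At y κ‖ ≤ a₁) ∧
        (L : ℝ) ^ (k + 1) * a₀ ≤ C₀ * (r + 4 * (Real.exp β - 1) + ε) ∧ ((L : ℝ) ^ (k + 1)) ^ 2 * a₁ ≤ C₁ * (r + 4 * (Real.exp β - 1) + ε) ∧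
        (∀ (y : Site (d + 1)) (κ : Fin (d + 1)),
          torusSupNorm (fun _ : Fin (d + 1) => L ^ (k + 1) * (1 * (4 * ℓ + 12))) (y - z) ≤ (((nbRad (d + 1) L + 2 * ℓ + 10) * L ^ (k + 1) : ℕ) : ℝ) →
            gaugeAct u U y κ = vary (flat (d := d + 1) (n := n)) At 1 y κ)) :=
  not_chart_cover12 (d := d) (n := n) (C₁ := C₁) hL ℓ (N := 1) le_rfl hε hβ (by unfold nbRad; omega) (by simpa using hsmall)

end

end Summit.QuantumFields.BalabanUV.T4Continuum.NE7LocalChartCoverObstruction
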